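import Summits.BirchSwinnertonDyer.BirchSwinnertonDyer.Theorems.ClassRecordThreeCornerTwistWitnessDefs
import Summits.BirchSwinnertonDyer.Rank1Residual.X11b.Three.CornerDischarge
import HarnessLib

/-!
# Routes `ClassRecordThree` / `KolyvaginRoadThree` (rung K2@3), crux 7 `CornerAtThree` (item
# stmt-BirchSwinnertonDyer-19111): the three corner CONSUMERS of the (Tw) conjunct REPLAYED at the ∃-recut
# `CornerTwistWitnessAt` (cell `bsd-stepL`, seat `bsd-stepL-mult-p3` g4; plan g37 RULING 33 STEP 1 — replays part)

`--supports stmt-BirchSwinnertonDyer-19111 --as helper`. Theorems only; no definition, no named fact, no `sorry`; imports NO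
Theses file and NO `Cruxes/` file. NO new mathematics: three replays of existing corner consumers at a SUPPLIED field. The two
`closes`-kernel twins that consume them are `Theorems/ClassRecordThreeCornerTwistWitnessKernel.lean`.

## What this file does

The (Tw) conjunct `X11b.Three.CornerTwistAt W` (∀ odd Heegner `K`) of crux `CornerAtThree` is consumed ONLY EXISTENTIALLY
(plan g37 RULING 33 FINDING): its consumers `missingUpperBoundAt_of_cornerUpperAt` (`Three/CornerResidual.lean`),
`missingLowerBoundAt_of_cornerStepLAt_of_cornerTwistAt` (`Three/CornerSplitResidual.lean`) and
`missingPPartAt_of_corner_of_inputs` (`Three/CornerDischarge.lean`, reached through the pass-through wrappers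
`…_nonsplit_of_inputs` ∕ `…_split_of_inputs`) each pick ONE field by `exists_oddHeegnerData` and apply (Tw) there; the last
is the final call of BOTH routes' `closes` kernels `multiplicativeRankOneAtThree_of_classRecord_upperB` ∕
`…_of_kolyRecord_upperB`. Here, with `CornerTwistWitnessAt W` (`Theorems/ClassRecordThreeCornerTwistWitnessDefs.lean`:
SOME odd Heegner field `K`, `d_K < -4`, Heegner for `N_E` and `3`, `L(E^{d_K},1) ≠ 0`, a global minimal twist model `Wd`
with `BSDp Wd 3`) in place of (Tw):

* §1 `CornerTwistWitness.missingLowerBoundAt_of_cornerStepLAt_of_cornerTwistWitnessAt` ∕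
  `CornerTwistWitness.missingUpperBoundAt_of_cornerUpperAt_of_cornerTwistWitnessAt` — the first two consumers REPLAYED at the
  supplied field (the Manin-good Heegner datum over THAT `K` from `exists_maninDatum_of_odd`; `CornerStepLAt` ∕ `CornerUpperAt`,
  still ∀-`K`, applied at the supplied `K`); same PUBLISHED binders minus Hoffstein–Luo (ports of the planner-checked sketch
  `Cruxes/CornerAtThree/IdeaOneDatumRecutUnitTwinSketch.lean` ll. 121 ∕ 167);
* §2 `CornerTwistWitness.missingPPartAt_of_corner_of_witness` — the third consumer's twin: the binder list of
  `Three.missingPPartAt_of_corner_of_inputs` with `hHL` dropped and `hL` ∕ `hTw` replaced by `(hSL : CornerStepLAt W)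
  (hWit : CornerTwistWitnessAt W)`, `hU` kept; lower half = §1, upper half = `hU` on the Tamagawa cells, else Matar–Nekovář 2019
  Thm. 0.3 + the twin's `≥`-half replayed at the witness (`d_K ≠ -3, -4` from `d_K < -4`).

The recut is STRICTLY WEAKER than (Tw) (`CornerTwistWitness.cornerTwistWitnessAt_of_cornerTwistAt`, definitions home) and,
by these replays, closes-SUFFICIENT (the `closes` twins in `…CornerTwistWitnessKernel.lean`).

HONEST FRAMING: kernel re-plumbing; CONDITIONAL on every binder (named published facts + the routes' typed inputs); nothing
booked; no census word, tier or label moves (T7); O2 stays OPEN; BSD(E,3) is proved for no class by this file.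

References: those of `Three/CornerDischarge.lean` ∕ `Three/CornerResidual.lean` — [MatarNekovar2019] Thm. 0.3, §0.4, §0.11,
Cor. 5.21 (e′), Prop. 5.26 (2) (JTNB 31 (2019) pp. 456–457, 490–492); [JetchevSkinnerWan2017] §7.4.1–7.4.2;
[Castella2018] Thm. 2.3, Thm. 3.2; [GrossZagier1986] I.(6.3), V.(2.2); [KolyvaginEulerSystems1990] Cor. 13;
[HoffsteinLuo1997] §1; [Mazur1978] Cor. 4.1; [Miller2011LMS] Def. 1.1; cell board RULING 33 (2026-08-27T18:14Z).
-/

noncomputable section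

open scoped Classical

open WeierstrassCurve NumberField IsDedekindDomain Field Literature.NumberTheory.EllipticCurves
  Rat.HeightOneSpectrum
  Literature.NumberTheory.DiophantineGeometry
  Literature.NumberTheory.EllipticCurves.GreenbergSelmer
  Literature.NumberTheory.EllipticCurves.ModularForms
  Literature.NumberTheory.EllipticCurves.Rank1Residual
  Literature.NumberTheory.EllipticCurves.Rank1Residual.Typed
  Literature.NumberTheory.EllipticCurves.Wuthrich2014
  Literature.NumberTheory.EllipticCurves.BalakrishnanEtAl2019
  Literature.NumberTheory.QuadraticFields.Quadratic
  Literature.NumberTheory.Automorphic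
  Literature.NumberTheory.GaloisRepresentations Literature.NumberTheory.GaloisCohomology
  Summit.BirchSwinnertonDyer.Rank1Residual.X11b.AcSelmer
  Summit.BirchSwinnertonDyer.Rank1Residual.X11b.LocBridge
  Summit.BirchSwinnertonDyer.Rank1Residual
  Summit.BirchSwinnertonDyer.Rank1Residual.X11b
  Summit.BirchSwinnertonDyer.Rank1Residual.X11b.Three

-- the cell's Theorems namespace repeats the summit name (Summit.<Summit>.<Problem>), as in every sibling file
set_option linter.dupNamespace false

namespace Summit.BirchSwinnertonDyer.BirchSwinnertonDyer.Theorems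

namespace CornerTwistWitness

/-! ### §1. The first two consumers replayed at the supplied field -/

/-- **The recut SUFFICES for the lower half `ord₃ #Ш(E)_an ≤ ord₃ #Ш(E)` on the corner** — replay of
`X11b.Three.missingLowerBoundAt_of_cornerStepLAt_of_cornerTwistAt` with `exists_oddHeegnerData` replaced by the supplied
witness: the field `K` and the twin's `BSD₃` come from `CornerTwistWitnessAt W`; `3 ∤ d_K` from `3` split
(`not_dvd_discr_of_split`), `w_K = 2` from `d_K < -4`; the Manin-good Heegner datum over THAT `K` from
`exists_maninDatum_of_odd` (modularity `hnf`, Mazur 1978 Cor. 4.1 `hMaz`, Néron scaling a theorem); the transports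
`ord₃ ∏c(Wd) = ord₃ ∏c(W)`, `ord₃ u(Cd) = 0` are theorems; the twin's `≤`-half in `PPartRankZero` currency from `BSDp Wd 3`
(`pPart_of_bsdp`, `pPartRankZero_of_pPart`; `r_an(Wd) = 0` by `hmod`); STEP L (`CornerStepLAt`, ∀-`K`) applied at the
supplied `K` through the image-free `indexLowerBoundAt_of_cornerStepLAt` (Poitou–Tate `hPT`, local Euler characteristic
`hEP`); assembled by `missingLowerBoundAt_of_indexLowerBoundAt`. Same PUBLISHED binders as the original minus Hoffstein–Luo.
CONDITIONAL on `CornerStepLAt W` and `CornerTwistWitnessAt W`; nothing booked.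
-- adapted from Summits/BirchSwinnertonDyer/BirchSwinnertonDyer/Cruxes/CornerAtThree/IdeaOneDatumRecutUnitTwinSketch.lean (l. 121)
[cite: JetchevSkinnerWan2017, §7.4.1 (eq:shalowerK-1)–(eq:shalower), pp. 30–31] [cite: Mazur1978, Cor. 4.1]
[cite: Miller2011LMS, Def. 1.1] -/
theorem missingLowerBoundAt_of_cornerStepLAt_of_cornerTwistWitnessAt [Fact (Nat.Prime 3)]
    (hGZ : ∀ (N : ℕ) [NeZero N] (W : WeierstrassCurve ℚ) (K : Type) [Field K] [NumberField K],
      gross_zagier N W K)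
    (hKo : ∀ (N : ℕ) [NeZero N] (W : WeierstrassCurve ℚ) (K : Type) [Field K] [NumberField K],
      kolyvagin N W K)
    (hGZK : rank_eq_analyticRank_of_analyticRank_le_one) (hmod : hasEntireLFunction_rat)
    (hnf : exists_isNewformOf) (hMaz : mazur_not_dvd_maninConstant_of_odd)
    (hPT : ∀ (K : Type) [Field K] [NumberField K], poitouTate_sum_localTatePairing_eq_zero K)
    (hEP : ∀ (K : Type) [Field K] [NumberField K] (v : HeightOneSpectrum (𝓞 K)),
      localEulerPoincareCharacteristic (v.adicCompletion K))
    (W : WeierstrassCurve ℚ) [W.IsElliptic] [W.IsGloballyMinimal] (hX : ClassX11b W 3)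
    (hns : ¬ Surj W 3) (hSL : CornerStepLAt W) (hWit : CornerTwistWitnessAt W) :
    Typed.MissingLowerBoundAt W 3 := by
  have hNS : integral_neronScaling_of_isGloballyMinimal :=
    integral_neronScaling_of_isGloballyMinimal_holds
  obtain ⟨hr, hp2, hmult, hirr⟩ := id hX
  haveI : NeZero (W.conductorNorm ℤ) := ⟨(W.conductorNorm_pos_holds).ne'⟩
  obtain ⟨K, _, _, Wd, _, _, Cd, hK, hodd, hlt, hHN, hH3, hLt, hWd, hbsd⟩ := hWit hX hns
  have hpd : ¬ (3 : ℤ) ∣ NumberField.discr K := not_dvd_discr_of_split hK Nat.prime_three hp2 hH3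
  have hμ : ¬ 3 ∣ Units.torsionOrder K := by
    haveI : IsTotallyComplex K := hK.2
    rw [Literature.NumberTheory.DiophantineGeometry.torsionOrder_eq_two_of_discr_lt hK.1 hlt]
    omega
  obtain ⟨Dt, H, ι, P, hP, hc⟩ :=
    exists_maninDatum_of_odd hnf hMaz hNS W 3 (W.conductorNorm ℤ) K rfl hp2 hmult hirr hK hHN
  have htam : padicValNat 3 Wd.tamagawaProduct = padicValNat 3 W.tamagawaProduct :=
    X2.padicValNat_tamagawaProduct_twist_of_heegner_of_odd W 3 hp2 K hK hodd hpd hHN Cd hWd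
  have hu : padicValRat 3 (Cd.u : ℚ) = 0 :=
    padicValRat_u_eq_zero_of_twist_minimal W 3 K hK hHN hmult Cd hWd
  -- the twin's `≤`-half in `PPartRankZero` currency, from the supplied `BSDp Wd 3`
  have hD0 : (NumberField.discr K : ℚ) ≠ 0 := by exact_mod_cast NumberField.discr_ne_zero K
  haveI hEt : (W.quadraticTwist (NumberField.discr K : ℚ)).IsElliptic := W.isElliptic_quadraticTwist hD0
  have hLt' : (W.quadraticTwist (NumberField.discr K : ℚ)).entireLFunction = Wd.entireLFunction := by
    rw [← hWd, entireLFunction_smul]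
  have hLd1 : Wd.entireLFunction 1 ≠ 0 := by rw [← hLt']; exact hLt
  have hrd : Wd.analyticRank = 0 := (Wd.analyticRank_eq_zero_iff_holds (hmod Wd)).2 hLd1
  obtain ⟨qd, hqd, hv⟩ : PPartRankZero Wd 3 :=
    pPartRankZero_of_pPart hGZK Wd 3 hrd (pPart_of_bsdp hmod hGZK Wd 3 (by omega) hbsd)
  exact missingLowerBoundAt_of_indexLowerBoundAt W 3 (W.conductorNorm ℤ) K Dt H ι P (hGZ _ W K)
    (hKo _ W K) hGZK hmod hK hHN hP hp2 hc hμ hr hLt Wd Cd hWd hu htam ⟨qd, hqd, hv.ge⟩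
    (fun _ ↦ indexLowerBoundAt_of_cornerStepLAt hGZ hKo hmod hPT hEP W hX hns hSL (W.conductorNorm ℤ)
      K Dt H ι P rfl hK hodd hHN hLt hP hc)

/-- **The recut SUFFICES for the Euler-system half `ord₃ #Ш(E) ≤ ord₃ #Ш(E)_an` on the corner's Tamagawa cells
`3 ∣ ∏_ℓ c_ℓ(E)`** — replay of `X11b.Three.missingUpperBoundAt_of_cornerUpperAt` at the supplied witness: the sharp
Kolyvagin bound `CornerUpperAt W` (∀-`K`) applied at the supplied `K` and the Manin-good datum over it
(`exists_maninDatum_of_odd`), the twin's `≥`-half from `BSDp Wd 3`, the transports as theorems, assembled by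
`missingUpperBoundAt_of_shaIndexBound_sharp` with weight `w = ord₃ ∏c_ℓ(E)`; `Ш(E/K)` finite by Gross–Zagier + Kolyvagin.
Same PUBLISHED binders as the original minus Hoffstein–Luo. CONDITIONAL on `CornerUpperAt W` and `CornerTwistWitnessAt W`;
nothing booked.
-- adapted from Summits/BirchSwinnertonDyer/BirchSwinnertonDyer/Cruxes/CornerAtThree/IdeaOneDatumRecutUnitTwinSketch.lean (l. 167)
[cite: JetchevSkinnerWan2017, §7.4.2 (eq:shaupper), p. 31] [cite: Mazur1978, Cor. 4.1] [cite: Miller2011LMS, Def. 1.1] -/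
theorem missingUpperBoundAt_of_cornerUpperAt_of_cornerTwistWitnessAt [Fact (Nat.Prime 3)]
    (hGZ : ∀ (N : ℕ) [NeZero N] (W : WeierstrassCurve ℚ) (K : Type) [Field K] [NumberField K],
      gross_zagier N W K)
    (hKo : ∀ (N : ℕ) [NeZero N] (W : WeierstrassCurve ℚ) (K : Type) [Field K] [NumberField K],
      kolyvagin N W K)
    (hGZK : rank_eq_analyticRank_of_analyticRank_le_one) (hmod : hasEntireLFunction_rat)
    (hnf : exists_isNewformOf) (hMaz : mazur_not_dvd_maninConstant_of_odd)
    (W : WeierstrassCurve ℚ) [W.IsElliptic] [W.IsGloballyMinimal] (hX : ClassX11b W 3)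
    (hns : ¬ Surj W 3) (ht : 3 ∣ W.tamagawaProduct) (hU : CornerUpperAt W) (hWit : CornerTwistWitnessAt W) :
    Typed.MissingUpperBoundAt W 3 := by
  have hNS : integral_neronScaling_of_isGloballyMinimal :=
    integral_neronScaling_of_isGloballyMinimal_holds
  obtain ⟨hr, hp2, hmult, hirr⟩ := id hX
  haveI : NeZero (W.conductorNorm ℤ) := ⟨(W.conductorNorm_pos_holds).ne'⟩
  obtain ⟨K, _, _, Wd, _, _, Cd, hK, hodd, hlt, hHN, hH3, hLt, hWd, hbsd⟩ := hWit hX hns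
  have hpd : ¬ (3 : ℤ) ∣ NumberField.discr K := not_dvd_discr_of_split hK Nat.prime_three hp2 hH3
  have hμ : ¬ 3 ∣ Units.torsionOrder K := by
    haveI : IsTotallyComplex K := hK.2
    rw [Literature.NumberTheory.DiophantineGeometry.torsionOrder_eq_two_of_discr_lt hK.1 hlt]
    omega
  obtain ⟨Dt, H, ι, P, hP, hc⟩ :=
    exists_maninDatum_of_odd hnf hMaz hNS W 3 (W.conductorNorm ℤ) K rfl hp2 hmult hirr hK hHN
  have htam : padicValNat 3 Wd.tamagawaProduct = padicValNat 3 W.tamagawaProduct :=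
    X2.padicValNat_tamagawaProduct_twist_of_heegner_of_odd W 3 hp2 K hK hodd hpd hHN Cd hWd
  have hu : padicValRat 3 (Cd.u : ℚ) = 0 :=
    padicValRat_u_eq_zero_of_twist_minimal W 3 K hK hHN hmult Cd hWd
  have hD0 : (NumberField.discr K : ℚ) ≠ 0 := by exact_mod_cast NumberField.discr_ne_zero K
  haveI hEt : (W.quadraticTwist (NumberField.discr K : ℚ)).IsElliptic := W.isElliptic_quadraticTwist hD0
  have hLt' : (W.quadraticTwist (NumberField.discr K : ℚ)).entireLFunction = Wd.entireLFunction := by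
    rw [← hWd, entireLFunction_smul]
  have hLd1 : Wd.entireLFunction 1 ≠ 0 := by rw [← hLt']; exact hLt
  have hrd : Wd.analyticRank = 0 := (Wd.analyticRank_eq_zero_iff_holds (hmod Wd)).2 hLd1
  obtain ⟨qd, hqd, hv⟩ : PPartRankZero Wd 3 :=
    pPartRankZero_of_pPart hGZK Wd 3 hrd (pPart_of_bsdp hmod hGZK Wd 3 (by omega) hbsd)
  exact missingUpperBoundAt_of_shaIndexBound_sharp W 3 (W.conductorNorm ℤ) K Dt H ι P (hGZ _ W K)
    (hKo _ W K) hGZK hmod hK hHN hP hp2 hc hμ hr hLt Wd Cd hWd hu htam le_rfl ⟨qd, hqd, hv.le⟩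
    (fun hfin hPinf ↦ hU (W.conductorNorm ℤ) K Dt H ι P hX hns ht rfl hK hodd hHN hLt hP hc hPinf hfin)

/-! ### §2. The third consumer's twin: `MissingPPartAt` on the whole corner from STEP L, the WITNESS and (U♯) -/

/-- **THE (T4″)@3 CORNER OF X11b FROM STEP L, ONE ODD HEEGNER TWIN AND (U♯)** — the twin of
`Three.missingPPartAt_of_corner_of_inputs` with its ∀-`K` input (Tw) replaced by the WITNESS `CornerTwistWitnessAt W`
(and (L) packaged as `CornerStepLAt W`); Hoffstein–Luo drops from the binder list. For `(E,3) ∈` X11b with `ρ̄_{E,3}`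
NOT surjective: `Typed.MissingPPartAt W 3` (`ord₃ #Ш(E) = ord₃ #Ш(E)_an`) from the PUBLISHED facts Gross–Zagier
(`hGZ`), Kolyvagin finiteness (`hKo`), GZK, modularity (`hmod`, `hnf`), Mazur 1978 Cor. 4.1 (`hMaz`), Poitou–Tate
(`hPT`), local Euler characteristic (`hEP`), **Matar–Nekovář 2019 Thm. 0.3** (`hMN`, irreducibility only; `d_K ≠ -3, -4`
from `d_K < -4`), and the TYPED inputs STEP L on the corner (`hSL`), the twin witness (`hWit`), the Euler-system half on
the Tamagawa cells (`hU`). Lower half = §1; upper half = `hU` if `3 ∣ ∏c(E)`, else — at the witness field `K`, the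
Manin-good datum over it (`exists_maninDatum_of_odd`) and the twin's `≥`-half (`exists_LOne_div_realPeriodRat_of_bsdp_rankZero`)
— `missingUpperBoundAt_of_shaIndexBound` with the `K`-bound from `hMN` (the original's ll. 241–247 replayed at the
witness). The sign of `E` at `3` is not used. CONDITIONAL on the typed inputs; nothing booked; O2 OPEN.
-- adapted from Summits/BirchSwinnertonDyer/Rank1Residual/X11b/Three/CornerDischarge.lean (§2)
[cite: MatarNekovar2019, Thm. 0.3 (p. 456), §0.4, §0.11 (p. 457), Cor. 5.21 (e′), Prop. 5.26 (2)]
[cite: JetchevSkinnerWan2017, §7.4.1–7.4.2 (pp. 30–31)] [cite: Mazur1978, Cor. 4.1] [cite: Miller2011LMS, Def. 1.1] -/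
theorem missingPPartAt_of_corner_of_witness [Fact (Nat.Prime 3)]
    (hGZ : ∀ (N : ℕ) [NeZero N] (W : WeierstrassCurve ℚ) (K : Type) [Field K] [NumberField K],
      gross_zagier N W K)
    (hKo : ∀ (N : ℕ) [NeZero N] (W : WeierstrassCurve ℚ) (K : Type) [Field K] [NumberField K],
      kolyvagin N W K)
    (hGZK : rank_eq_analyticRank_of_analyticRank_le_one) (hmod : hasEntireLFunction_rat)
    (hnf : exists_isNewformOf) (hMaz : mazur_not_dvd_maninConstant_of_odd)
    (hPT : ∀ (K : Type) [Field K] [NumberField K], poitouTate_sum_localTatePairing_eq_zero K)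
    (hEP : ∀ (K : Type) [Field K] [NumberField K] (v : HeightOneSpectrum (𝓞 K)),
      localEulerPoincareCharacteristic (v.adicCompletion K))
    (hMN : ∀ (N : ℕ) [NeZero N] (W : WeierstrassCurve ℚ) (K : Type) [Field K] [NumberField K],
      MatarNekovar2019.thm03_padicValNat_card_sha_le_of_irreducible N W K)
    (W : WeierstrassCurve ℚ) [W.IsElliptic] [W.IsGloballyMinimal] (hX : ClassX11b W 3)
    (hns : ¬ Surj W 3)
    -- (L) image-free STEP L on the corner — NO source at `3`
    (hSL : CornerStepLAt W)
    -- (Tw∃) ONE odd Heegner twin with `BSD(E^{d_K},3)` — NO source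
    (hWit : CornerTwistWitnessAt W)
    -- (U♯) the Euler-system half when `3 ∣ ∏c(E)` (Tamagawa-sharp typing)
    (hU : 3 ∣ W.tamagawaProduct → Typed.MissingUpperBoundAt W 3) :
    Typed.MissingPPartAt W 3 := by
  refine Typed.missingPPartAt_of_lower_of_upper W 3
    (missingLowerBoundAt_of_cornerStepLAt_of_cornerTwistWitnessAt hGZ hKo hGZK hmod hnf hMaz hPT hEP W hX hns
      hSL hWit) ?_
  by_cases ht : 3 ∣ W.tamagawaProduct
  · exact hU ht
  · -- `3 ∤ ∏c`: Matar–Nekovář + the twin's `≥`-half, at the WITNESS field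
    have hNS : integral_neronScaling_of_isGloballyMinimal :=
      integral_neronScaling_of_isGloballyMinimal_holds
    obtain ⟨hr, hp2, hmult, hirr⟩ := id hX
    haveI : NeZero (W.conductorNorm ℤ) := ⟨(W.conductorNorm_pos_holds).ne'⟩
    obtain ⟨K, _, _, Wd, _, _, Cd, hK, hodd, hlt, hHN, hH3, hLt, hWd, hbsd⟩ := hWit hX hns
    have hpd : ¬ (3 : ℤ) ∣ NumberField.discr K := not_dvd_discr_of_split hK Nat.prime_three hp2 hH3
    have hμ : ¬ 3 ∣ Units.torsionOrder K := by
      haveI : IsTotallyComplex K := hK.2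
      rw [Literature.NumberTheory.DiophantineGeometry.torsionOrder_eq_two_of_discr_lt hK.1 hlt]
      omega
    obtain ⟨Dt, H, ι, P, hP, hc⟩ :=
      exists_maninDatum_of_odd hnf hMaz hNS W 3 (W.conductorNorm ℤ) K rfl hp2 hmult hirr hK hHN
    have htam : padicValNat 3 Wd.tamagawaProduct = padicValNat 3 W.tamagawaProduct :=
      X2.padicValNat_tamagawaProduct_twist_of_heegner_of_odd W 3 hp2 K hK hodd hpd hHN Cd hWd
    have hu : padicValRat 3 (Cd.u : ℚ) = 0 :=
      padicValRat_u_eq_zero_of_twist_minimal W 3 K hK hHN hmult Cd hWd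
    have hD0 : (NumberField.discr K : ℚ) ≠ 0 := by exact_mod_cast NumberField.discr_ne_zero K
    haveI hEt : (W.quadraticTwist (NumberField.discr K : ℚ)).IsElliptic := W.isElliptic_quadraticTwist hD0
    have hLt' : (W.quadraticTwist (NumberField.discr K : ℚ)).entireLFunction = Wd.entireLFunction := by
      rw [← hWd, entireLFunction_smul]
    have hLd1 : Wd.entireLFunction 1 ≠ 0 := by rw [← hLt']; exact hLt
    have hrd : Wd.analyticRank = 0 := (Wd.analyticRank_eq_zero_iff_holds (hmod Wd)).2 hLd1
    -- the twin's `3`-part from the witness, as the leading-term display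
    obtain ⟨qd, hqd, hvqd⟩ := exists_LOne_div_realPeriodRat_of_bsdp_rankZero hGZK hmod Wd 3 hrd hbsd
    have hD3 : NumberField.discr K ≠ -3 := by omega
    have hD4 : NumberField.discr K ≠ -4 := by omega
    exact missingUpperBoundAt_of_shaIndexBound W 3 (W.conductorNorm ℤ) K Dt H ι P (hGZ _ W K)
      (hKo _ W K) hGZK hmod hK hHN hP hp2 hc hμ hr hLt Wd Cd hWd hu htam ht ⟨qd, hqd, hvqd.le⟩
      (fun _ hnt ↦ hMN _ W K hK hHN hD3 hD4 ⟨Dt, H, ι, hP⟩ hnt Nat.prime_three (by decide) hirr)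

end CornerTwistWitness

end Summit.BirchSwinnertonDyer.BirchSwinnertonDyer.Theorems

end
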